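/-
Copyright (c) 2026 the pub-hodgecm-mathlib formalisation cell (harness21).  Prover seat hodgecm-mathlib-F0P3-p02 (g18): line LH3 (closer stub `stub_N9`), organ J,
brick (J-G′-BLOCK-INST) «`hγ`∕`r₀` ALONG THE NORMAL» (LH3-plan (g3) 2026-09-02T08:22:51Z «=») for LH3-p02 (g3)'s (J-G′-JUMP) piece (c).
-/
import Literature.NumberTheory.Rogawski1990.ArchCartanWallExtensionGDocks        -- ★ p850260∕p850265 (LH3-p02 (g2)): `add_smul_hcNrm_apply_self ∕ _of_ne`; brings ★ `ArchHCSpaceG` (`hcNrm`)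
import Literature.NumberTheory.Automorphic.ArchInnerFormCartanAtlasCentralizer    -- ★ p849697 (LH3-p03 (g2)): `gprimeTorus_mem_centralizer`; brings ★ `ArchInnerFormCartanAtlas` (`gprimeTorus`)
import Literature.NumberTheory.Automorphic.ArchRankOneJumpZeroCone               -- ★ p850353 (F0P3a-p07 (g16)) (K0±-FORM-TRANSPORT): `cayley_conj_circleDiagonal_mem_of_eq_over`, `det_cayleyTwo_ne_zero`, the `U(J)` currency
import HarnessLib

/-!
# (J-G′-BLOCK-INST): the block coordinates of the chart point `gprimeTorus α S (p + ν • hcNrm w₀ 0 2)` along the wall normal — `(z·diag(e^{iν}, e^{−iν}), r₀)` with `r₀` FIXED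
# (Rogawski 1990 §8.2 pp. 119–124, §3.6; Shelstad 1979 §4)

Topic `NumberTheory/Rogawski1990`; namespace `Literature.NumberTheory.Rogawski1990`.  THEOREMS ONLY (no `def`, no instance, no notation, no axiom, no named fact, no `sorry`);
kernel lane `--kind proof --supports stmt-HodgeConjecture-24833`.  Cell `pub/hodgecm-mathlib`, crux H413 (`stmt-HodgeConjecture-24833`), F0∕P3c line LH3 (closer stub `stub_N9`,
DIRECT ROAD `F0_P3c_StubN9Direct`, organ J `JumpAgreementStatement`), brick **(J-G′-BLOCK-INST)** (LH3-plan (g3) 2026-09-02T08:22:51Z «=», seat F0P3-p02 (g18)): the binder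
**`hγ : ∀ ν, eM ⟨gprimeTorus L α S (p + ν • hcNrm w₀ 0 2), _⟩ = (γ_B ν, r₀)`** of ★ (J-G′-BLOCK) `chartOrbG_add_smul_hcNrm_eventuallyEq_of_block` ∕ `exists_block_testFunction_chartOrbG_eventuallyEq`
(p850417, this seat), DISCHARGED IN BINDER FORM over the clauses [5] + [6] of ★ (M-UNFOLD) (u2) `exists_continuousMulEquiv_centralizer_gprimeTorus_semireg` (p850446, LH5-p02 (g3):
`e : ↥Z(s) ≃ₜ* ↥B × ↥K`, `(e γ_c).1 = diag(e^{iθ₀(c)}, e^{iθ₂(c)})`, `(e γ_c).2 = γ_{c ↦ (0, θ₁(c), 0) at w₀}`) and clause (i) of (B-STD) `exists_continuousMulEquiv_diagonal_weights_std`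
(LH3-plan (g3) RULINGS #9, F0P3a-p07 (g16): `φ : ↥B ≃ₜ* ↥U(J)`, `φ(diag u) = P·diag(u)·P⁻¹`, `J = (StdForm.antidiagonal 2).over ℂ`), for an ABSTRACT standardised block equivalence
`e′ : ↥Z(s) ≃ₜ* ↥U(J) × ↥K` with `he′ : ∀ g, e′ g = (φ (e g).1, (e g).2)` (LH3-p02 (g3) TOKEN NOTE 08:21:57Z: `ContinuousMulEquiv.prodCongr` does not exist; the composite is never
spelled — ★∕filing `exists_continuousMulEquiv_prodMap` supplies `e′`).  OUTPUT: **`γ_B ν = ⟨P · circleDiagonal 2 ![z·e^{iν}, z·e^{−iν}] · P⁻¹, _⟩`, `z = Circle.exp (p w₀ 0)`, EXACTLY the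
torus element of ★ (K0±-FORM-TRANSPORT) `exists_hasOneSidedJump_two_sin_mul_orbitalIntegral_group_of_eq_over` (p850353) at `ψ := ν`, and `r₀ = (e γ_p).2`** — so LH3-p02 (g3)'s
piece (c) feeds ★ p850417 and ★ p850353 at the SAME element with no rewriting under the integral.

THE MATHEMATICS (Rogawski §8.2 p. 122, Shelstad §4 p. 25).  On the compact wall `θ₀ = θ₂` at `w₀` (`p w₀ 0 = p w₀ 2 = θ`), the normal curve `c_ν = p + ν • hcNrm w₀ 0 2` has
`w₀`-angles `(θ + ν, θ₁, θ − ν)` and freezes every other coordinate (★ `add_smul_hcNrm_apply_self ∕ _of_ne`).  Hence: (1) the wall block of `γ_{c_ν}` is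
`diag(e^{i(θ+ν)}, e^{i(θ−ν)}) = z·diag(e^{iν}, e^{−iν})`, `z = e^{iθ}` ([5] + `Circle.exp_add`); (2) the complementary coordinate `(e γ_{c_ν}).2` only reads `c_ν` off the two
moving slots — `Function.update c_ν w₀ (0, (c_ν) w₀ 1, 0) = Function.update p w₀ (0, p w₀ 1, 0)` — so it is CONSTANT `= (e γ_p).2` ([6] + injectivity of `↥K → ↥Z(s) → G′_∞`);
(3) through `φ`, the block coordinate becomes the Cayley-torus element `P·(z·diag(e^{iν}, e^{−iν}))·P⁻¹` of `U(J)`.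

* §1 coordinates of the normal curve: `circleExp_add_smul_hcNrm_zero ∕ _two` (`= z · e^{±iν}`), `update_add_smul_hcNrm_eq` (the frozen complementary coordinate);
* §2 in `e`'s coordinates: `e_gprimeTorus_add_smul_hcNrm_fst_eq` ([5] on the normal), `e_gprimeTorus_add_smul_hcNrm_snd_eq` ((2): `(e γ_{c_ν}).2 = (e γ_p).2`);
* §3 **`eM_gprimeTorus_add_smul_hcNrm_eq`** — the `hγ` binder of ★ p850417 for the standardised `e′`, token-exact against ★ p850353's torus element.
HONEST LABEL: HC_CM is proved only modulo the 7 printed citations (2 remaining named inputs: hLiu418 = `stmt-HodgeConjecture-24832`, h413 = `stmt-HodgeConjecture-24833`) until rung 0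
closes; count-neutral coordinate bookkeeping under organ J of `stub_N9` (no stub closes by this file alone).

## References
* [Rogawski1990] J. D. Rogawski, *Automorphic Representations of Unitary Groups in Three Variables*, Ann. of Math. Stud. 123 (1990), §8.2 pp. 119–124 (the `U(1,1)`-block at a
  compact wall, `γ = z·diag(e^{iψ}, e^{−iψ})`), §3.6 p. 31 (the tori), §4.9 p. 54 (the Cayley frame).
* [Shelstad1979] D. Shelstad, *Characters and inner forms of a quasi-split group over ℝ*, Compositio Math. 39 (1979), §4 pp. 22–25 (the normal to a compact wall).
-/

set_option autoImplicit false

noncomputable section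

open Set Filter Topology NumberField NumberField.InfinitePlace
open Literature.NumberTheory.Automorphic Literature.NumberTheory.Automorphic.UnitaryGroup
open scoped MatrixGroups Matrix Classical

namespace Literature.NumberTheory.Rogawski1990

/-! ## §1 Coordinates of the normal curve at the wall place -/

section Coordinates

variable {W : Type*} [DecidableEq W] (p : W → Fin 3 → ℝ) (w₀ : W)

/-- On the wall normal the slot-`0` angle at `w₀` is `θ₀ + ν`: `e^{i(c_ν)_{w₀,0}} = e^{iθ₀} · e^{iν}`. [cite: Shelstad1979, §4 p. 25] [cite: Rogawski1990, §8.2 p. 122] -/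
theorem circleExp_add_smul_hcNrm_zero (ν : ℝ) : Circle.exp ((p + ν • hcNrm w₀ 0 2) w₀ 0) = Circle.exp (p w₀ 0) * Circle.exp ν := by
  rw [add_smul_hcNrm_apply_self, ← Circle.exp_add]
  congr 1
  simp

/-- On the wall normal the slot-`2` angle at `w₀` is `θ₂ − ν`; ON the wall (`θ₀ = θ₂`): `e^{i(c_ν)_{w₀,2}} = e^{iθ₀} · e^{−iν}`. [cite: Shelstad1979, §4 p. 25] [cite: Rogawski1990, §8.2 p. 122] -/
theorem circleExp_add_smul_hcNrm_two (hp : p w₀ 0 = p w₀ 2) (ν : ℝ) : Circle.exp ((p + ν • hcNrm w₀ 0 2) w₀ 2) = Circle.exp (p w₀ 0) * Circle.exp (-ν) := by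
  rw [add_smul_hcNrm_apply_self, ← Circle.exp_add, hp]
  congr 1
  simp

/-- The complementary coordinate is frozen along the normal: zeroing the two moving slots of `c_ν` gives the same point as for `p`. [cite: Shelstad1979, §4 p. 25] -/
theorem update_add_smul_hcNrm_eq (ν : ℝ) :
    Function.update (p + ν • hcNrm w₀ 0 2) w₀ ![0, (p + ν • hcNrm w₀ 0 2) w₀ 1, 0] = Function.update p w₀ ![0, p w₀ 1, 0] := by
  have h1 : (p + ν • hcNrm w₀ 0 2) w₀ 1 = p w₀ 1 := by
    rw [add_smul_hcNrm_apply_self]; simp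
  rw [h1]
  funext w'
  by_cases hw : w' = w₀
  · subst hw; simp only [Function.update_self]
  · simp only [Function.update_of_ne hw, add_smul_hcNrm_apply_of_ne p ν hw]

end Coordinates

/-! ## §2 The chart point of the normal curve in the block coordinates `e` of ★ (M-UNFOLD) -/

section Block

variable (L : Type) [Field L] [NumberField L] [IsCMField L] (α : Fin 3 → L)
  (S : Finset {w : InfinitePlace L // IsComplex w}) (w₀ : {w : InfinitePlace L // IsComplex w}) (p : {w : InfinitePlace L // IsComplex w} → Fin 3 → ℝ)
  {B : Subgroup (GL (Fin 2) ℂ)}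
  (K : Subgroup ↥(Subgroup.centralizer ({gprimeTorus L α S p} : Set ↥(arch (↥(maximalRealSubfield L)) L (IsCMField.complexConj L) 3 (Matrix.diagonal α)))))
  (e : ↥(Subgroup.centralizer ({gprimeTorus L α S p} : Set ↥(arch (↥(maximalRealSubfield L)) L (IsCMField.complexConj L) 3 (Matrix.diagonal α)))) ≃ₜ* ↥B × ↥K)
  -- clause [5] of ★ `exists_continuousMulEquiv_centralizer_gprimeTorus_semireg`
  (h5 : ∀ c : {w : InfinitePlace L // IsComplex w} → Fin 3 → ℝ,
    ((e ⟨gprimeTorus L α S c, gprimeTorus_mem_centralizer L α S p c⟩).1 : GL (Fin 2) ℂ) = circleDiagonal 2 ![Circle.exp (c w₀ 0), Circle.exp (c w₀ 2)])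
  -- clause [6]
  (h6 : ∀ c : {w : InfinitePlace L // IsComplex w} → Fin 3 → ℝ,
    (((e ⟨gprimeTorus L α S c, gprimeTorus_mem_centralizer L α S p c⟩).2 : ↥(Subgroup.centralizer ({gprimeTorus L α S p} : Set ↥(arch (↥(maximalRealSubfield L)) L (IsCMField.complexConj L) 3 (Matrix.diagonal α))))) :
        ↥(arch (↥(maximalRealSubfield L)) L (IsCMField.complexConj L) 3 (Matrix.diagonal α))) =
      gprimeTorus L α S (Function.update c w₀ ![0, c w₀ 1, 0]))

include h5 in
/-- **[5] ON THE NORMAL**: the wall block of `γ_{c_ν}` is `z·diag(e^{iν}, e^{−iν})`, `z = e^{iθ₀}` (on the wall `θ₀ = θ₂`). [cite: Rogawski1990, §8.2 p. 122] [cite: Shelstad1979, §4 p. 25] -/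
theorem e_gprimeTorus_add_smul_hcNrm_fst_eq (hp : p w₀ 0 = p w₀ 2) (ν : ℝ) :
    ((e ⟨gprimeTorus L α S (p + ν • hcNrm w₀ 0 2), gprimeTorus_mem_centralizer L α S p _⟩).1 : GL (Fin 2) ℂ) =
      circleDiagonal 2 ![Circle.exp (p w₀ 0) * Circle.exp ν, Circle.exp (p w₀ 0) * Circle.exp (-ν)] := by
  rw [h5, circleExp_add_smul_hcNrm_zero, circleExp_add_smul_hcNrm_two p w₀ hp]

include h6 in
/-- **[6] ON THE NORMAL — THE COMPLEMENTARY COORDINATE IS FROZEN**: `(e γ_{c_ν}).2 = (e γ_p).2` for every `ν` (only the two wall slots at `w₀` move). [cite: Shelstad1979, §4 p. 25]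
[cite: Rogawski1990, §8.2 p. 122; §3.6 p. 31] -/
theorem e_gprimeTorus_add_smul_hcNrm_snd_eq (ν : ℝ) :
    (e ⟨gprimeTorus L α S (p + ν • hcNrm w₀ 0 2), gprimeTorus_mem_centralizer L α S p _⟩).2 = (e ⟨gprimeTorus L α S p, gprimeTorus_mem_centralizer L α S p p⟩).2 := by
  apply Subtype.ext
  apply Subtype.ext
  rw [h6, h6, update_add_smul_hcNrm_eq]

end Block

/-! ## §3 The `hγ` binder of ★ (J-G′-BLOCK) for the standardised block equivalence -/

section Standard

variable (L : Type) [Field L] [NumberField L] [IsCMField L] (α : Fin 3 → L)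
  (S : Finset {w : InfinitePlace L // IsComplex w}) (w₀ : {w : InfinitePlace L // IsComplex w}) (p : {w : InfinitePlace L // IsComplex w} → Fin 3 → ℝ)
  {B : Subgroup (GL (Fin 2) ℂ)}
  (K : Subgroup ↥(Subgroup.centralizer ({gprimeTorus L α S p} : Set ↥(arch (↥(maximalRealSubfield L)) L (IsCMField.complexConj L) 3 (Matrix.diagonal α)))))
  (e : ↥(Subgroup.centralizer ({gprimeTorus L α S p} : Set ↥(arch (↥(maximalRealSubfield L)) L (IsCMField.complexConj L) 3 (Matrix.diagonal α)))) ≃ₜ* ↥B × ↥K)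
  (h5 : ∀ c : {w : InfinitePlace L // IsComplex w} → Fin 3 → ℝ,
    ((e ⟨gprimeTorus L α S c, gprimeTorus_mem_centralizer L α S p c⟩).1 : GL (Fin 2) ℂ) = circleDiagonal 2 ![Circle.exp (c w₀ 0), Circle.exp (c w₀ 2)])
  (h6 : ∀ c : {w : InfinitePlace L // IsComplex w} → Fin 3 → ℝ,
    (((e ⟨gprimeTorus L α S c, gprimeTorus_mem_centralizer L α S p c⟩).2 : ↥(Subgroup.centralizer ({gprimeTorus L α S p} : Set ↥(arch (↥(maximalRealSubfield L)) L (IsCMField.complexConj L) 3 (Matrix.diagonal α))))) :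
        ↥(arch (↥(maximalRealSubfield L)) L (IsCMField.complexConj L) 3 (Matrix.diagonal α))) =
      gprimeTorus L α S (Function.update c w₀ ![0, c w₀ 1, 0]))
  {J : Matrix (Fin 2) (Fin 2) ℂ} (hJ : J = (StdForm.antidiagonal 2).over ℂ)
  (φ : ↥B ≃ₜ* ↥(unitaryGroupOfForm (starRingEnd ℂ) J))
  -- clause (i) of (B-STD) `exists_continuousMulEquiv_diagonal_weights_std`
  (hφ : ∀ (u : Fin 2 → Circle) (hu : circleDiagonal 2 u ∈ B),
    φ ⟨circleDiagonal 2 u, hu⟩ =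
      ⟨Matrix.GeneralLinearGroup.mkOfDetNeZero !![(1 : ℂ), 1; 1, -1] det_cayleyTwo_ne_zero * circleDiagonal 2 u *
          (Matrix.GeneralLinearGroup.mkOfDetNeZero !![(1 : ℂ), 1; 1, -1] det_cayleyTwo_ne_zero)⁻¹,
        cayley_conj_circleDiagonal_mem_of_eq_over hJ u⟩)
  -- the standardised block equivalence, bound abstractly (★ `exists_continuousMulEquiv_prodMap`)
  (e' : ↥(Subgroup.centralizer ({gprimeTorus L α S p} : Set ↥(arch (↥(maximalRealSubfield L)) L (IsCMField.complexConj L) 3 (Matrix.diagonal α)))) ≃ₜ*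
    ↥(unitaryGroupOfForm (starRingEnd ℂ) J) × ↥K)
  (he' : ∀ g, e' g = (φ (e g).1, (e g).2))

include h5 h6 hφ he' in
/-- **(J-G′-BLOCK-INST) — `hγ` ALONG THE NORMAL for the standardised block equivalence `e′ = (φ × id) ∘ e`:** on the wall `p w₀ 0 = p w₀ 2`,
`e′ γ_{p + ν • hcNrm w₀ 0 2} = (⟨P · circleDiagonal 2 ![z·e^{iν}, z·e^{−iν}] · P⁻¹, _⟩, (e γ_p).2)` with `z = Circle.exp (p w₀ 0)`, `P = (1 1; 1 −1)` — the first component is TOKEN-EXACT the torus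
element of ★ `exists_hasOneSidedJump_two_sin_mul_orbitalIntegral_group_of_eq_over` at `ψ := ν`, the second is CONSTANT (`r₀ := (e γ_p).2`); i.e. the `hγ` binder of ★
`exists_block_testFunction_chartOrbG_eventuallyEq` with `γB ν := ⟨P · circleDiagonal 2 ![z·e^{iν}, z·e^{−iν}] · P⁻¹, _⟩`, `r₀ := (e γ_p).2`.
[cite: Rogawski1990, §8.2 pp. 119–124; §4.9 p. 54] [cite: Shelstad1979, §4 pp. 22–25] -/
theorem eM_gprimeTorus_add_smul_hcNrm_eq (hp : p w₀ 0 = p w₀ 2) (ν : ℝ) :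
    e' ⟨gprimeTorus L α S (p + ν • hcNrm w₀ 0 2), gprimeTorus_mem_centralizer L α S p _⟩ =
      (⟨Matrix.GeneralLinearGroup.mkOfDetNeZero !![(1 : ℂ), 1; 1, -1] det_cayleyTwo_ne_zero *
            circleDiagonal 2 ![Circle.exp (p w₀ 0) * Circle.exp ν, Circle.exp (p w₀ 0) * Circle.exp (-ν)] *
            (Matrix.GeneralLinearGroup.mkOfDetNeZero !![(1 : ℂ), 1; 1, -1] det_cayleyTwo_ne_zero)⁻¹,
          cayley_conj_circleDiagonal_mem_of_eq_over hJ _⟩,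
        (e ⟨gprimeTorus L α S p, gprimeTorus_mem_centralizer L α S p p⟩).2) := by
  rw [he']
  have h1 : (e ⟨gprimeTorus L α S (p + ν • hcNrm w₀ 0 2), gprimeTorus_mem_centralizer L α S p _⟩).1 =
      ⟨circleDiagonal 2 ![Circle.exp (p w₀ 0) * Circle.exp ν, Circle.exp (p w₀ 0) * Circle.exp (-ν)],
        by rw [← e_gprimeTorus_add_smul_hcNrm_fst_eq L α S w₀ p K e h5 hp ν]; exact Subtype.coe_prop _⟩ :=
    Subtype.ext (e_gprimeTorus_add_smul_hcNrm_fst_eq L α S w₀ p K e h5 hp ν)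
  rw [h1, hφ, e_gprimeTorus_add_smul_hcNrm_snd_eq L α S w₀ p K e h6 ν]

end Standard

end Literature.NumberTheory.Rogawski1990

end
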